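import Summits.Ventures.PercRepro.RLSRuleTwoLinesT2
import Summits.Ventures.PercRepro.RLSRuleOneLineFiveT2
import Summits.Ventures.PercRepro.RLSRuleTypeZero
import Summits.Ventures.PercRepro.RLSRuleLineFreeSmall

/-!
# C-025 at q = 3: `R₃⁺` on EVERY `𝒯₀` plane at EVERY type on the core (night-3, gen 4)

The six small trace types `𝒯₀` are the simple planes with at most `5` points and no `4`-point line: `U_{3,3}`,
`U_{3,4}`, `ℓ₃ ∪ {a}`, `U_{3,5}`, `ℓ₃ ∪ {a, b}`, and «two `3`-lines through a point».  On a core matroid of rank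
`p = n + 4 ≥ 8` (simple, so a plane with `≤ 5` points and `≤ 2` dependent triples is exactly a `𝒯₀` plane) the
per-flat inequality of `R₃⁺` holds for each of them at every type `t = p − ρ(E ∖ G)`:

* no dependent triple: `perFlat_lineFree` (every type, every finite matroid);
* one: `|G| = 4` — `perFlat_three_line_point_all`; `|G| = 5` — `perFlat_oneLineFive_all`;
* two (then `|G| = 5`: two distinct `3`-lines of a plane without a `4`-line share at most one point):
  `perFlat_twoLines_all`.

**`perFlat_T0_all`** is the statement; `twoLines_of_twoLinesAny` the shape conversion.  The remaining gap of the lane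
is the same Prop on the planes OUTSIDE `𝒯₀` at `t ≥ 1` and with `≥ 3` lines at `t = 0` (paper: `N3-R3PLUS-plan.md`).
Imports `RLSRuleTwoLinesT2`, `RLSRuleOneLineFiveT2`, `RLSRuleTypeZero`, `RLSRuleLineFreeSmall`.  Axioms: standard.
-/

open scoped Matroid

namespace PercRepro

namespace NightThree

open Finset ThmH PerFlat

variable {α : Type*} [DecidableEq α] {M : Matroid α} [M.Finite]

omit [DecidableEq α] [M.Finite] in
/-- A `TwoLinesAny` plane with `5` points is a `TwoLines` plane. -/
theorem twoLines_of_twoLinesAny {G ℓ ℓ' : Finset α} (h : TwoLinesAny M G ℓ ℓ') (hGc : G.card = 5) :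
    TwoLines M G ℓ ℓ' := by
  obtain ⟨hℓG, hℓ'G, hℓc, hℓ'c, hℓr, hℓ'r, hne, hsimple, hind⟩ := h
  exact ⟨hℓG, hℓ'G, hℓc, hℓ'c, hℓr, hℓ'r, hne, hGc, hsimple, hind⟩

/-- Two distinct `3`-point lines of a plane without a `4`-point line need `5` points. -/
theorem five_le_card_of_twoLinesAny {G ℓ ℓ' : Finset α} (hG : G ∈ flatsQ M 3) (h : TwoLinesAny M G ℓ ℓ') :
    5 ≤ G.card := by
  have hinter := card_inter_le_one_of_twoLines' hG h
  have hunion := Finset.card_union_add_card_inter ℓ ℓ'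
  have hsub : ℓ ∪ ℓ' ⊆ G := Finset.union_subset h.1 h.2.1
  have := Finset.card_le_card hsub
  have hℓc := h.2.2.1
  have hℓ'c := h.2.2.2.1
  omega

open scoped Classical in
/-- **`R₃⁺` on every `𝒯₀` plane at every type on the core.**  On `Core M (n + 4)`, `n ≥ 4`, every plane `G` with at
most `5` points and at most two dependent triples satisfies `Φ(p, 3) · #U_G ≤ Σ_{S ∈ Yq} w⁺(G, S)`. -/
theorem perFlat_T0_all {G : Finset α} {n : ℕ} (hc : Core M (n + 4)) (hG : G ∈ flatsQ M 3) (hG5 : G.card ≤ 5)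
    (hdep : (depTriples M G).card ≤ 2) (hn : 4 ≤ n) :
    phiK (n + 4) 3 * ((UqG M (n + 4) 3 G).card : ℚ) ≤ ∑ S ∈ Yq M (n + 4) 3, wPlus M G S := by
  have hsimple : SimpleOn M G := simpleOn_of_core hc (mem_flatsQ.1 hG).1
  rcases Nat.lt_or_ge (depTriples M G).card 1 with h0 | h1
  · have hemp : depTriples M G = ∅ := Finset.card_eq_zero.1 (by omega)
    exact perFlat_lineFree hG (lineFree_of_depTriples_empty hemp) (by omega : 8 ≤ n + 4)
  rcases Nat.lt_or_ge (depTriples M G).card 2 with h1' | h2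
  · obtain ⟨ℓ, hℓ⟩ := Finset.card_eq_one.1 (by omega : (depTriples M G).card = 1)
    have hone := oneLine_of_depTriples_singleton hsimple hℓ
    have h4 := four_le_card_of_oneLine hG hone
    rcases (show G.card = 4 ∨ G.card = 5 by omega) with hGc | hGc
    · exact perFlat_three_line_point_all hc hG hone.1 hone.2.2.1 hone.2.1 hGc hsimple hn
    · exact perFlat_oneLineFive_all hc hG hone hGc hn
  · obtain ⟨ℓ, ℓ', hne, hℓℓ'⟩ := Finset.card_eq_two.1 (by omega : (depTriples M G).card = 2)
    have hany := twoLinesAny_of_depTriples_pair hsimple hne hℓℓ'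
    have hGc : G.card = 5 := le_antisymm hG5 (five_le_card_of_twoLinesAny hG hany)
    exact perFlat_twoLines_all hc hG (twoLines_of_twoLinesAny hany hGc) hn

end NightThree

end PercRepro
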